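import Summits.QuantumFields.YangMills.Theorems.AtomicCalibrationRGevreyGridBump
import Summits.QuantumFields.YangMills.Theorems.AtomicCalibrationRGevreyPairCutoff
import Summits.QuantumFields.YangMills.Theorems.AtomicCalibrationRGevreyLeibniz

/-!
# AtomicCalibrationR (stmt-QuantumFields-28169), E2 `stub_offDiagonalWhitney` — budget-free (Gevrey) rates of the band bumps
# (roadmap v3 item G.3, fourth instance; prover w4 g22, free hands)

Factorial-rate version of `AtomicCalibrationRBandBump`: with a Gevrey profile `ρ` (`‖ρ^{(j)}‖ ≤ C₀C₁^j (j!)^s`, `‖ρ‖ ≤ 1`) and a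
Gevrey step `ψ` (`‖ψ^{(i)}‖ ≤ C₀'C₁'^i (i!)^s`, `‖ψ‖ ≤ 1`, `ψ = 1` on `[4,∞)`, `0 ≤` the pair cut-offs `≤ 1`), the band bump
`(Π_{k+1} − Π_k) · gridBump ρ n h c` (where `Π_k = ∏_{l≠l'} ψ(4^k‖z_l−z_l'‖²)`) has, for EVERY order `j` and with constants
independent of any derivative budget,
`‖D^j‖ ≤ (j!)^{s+1} (2·n²·8C₀'C₁'·2^{k+1} + 4n C₀C₁/h)^j` (`norm_iteratedFDeriv_bandBump_le_gevrey`; `n ≥ 1`), and the far bump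
`Π_0 · gridBump` has `‖D^j‖ ≤ (j!)^{s+1} (n²·8C₀'C₁' + 4n C₀C₁/h)^j` (`norm_iteratedFDeriv_farBump_le_gevrey`).

No stub/crux/rung/summit is closed; nothing here touches Yang–Mills; the YM mass gap is NOT proved. [folklore]
-/

set_option autoImplicit false

noncomputable section

open scoped BigOperators ContDiff
open Set
open Summit.QuantumFields.YangMills.Cruxes.AtomicCalibrationR.PairCutoff (pairs)
open Summit.QuantumFields.YangMills.Cruxes.AtomicCalibrationR.GridPartition (gridBump contDiff_gridBump)
open Summit.QuantumFields.YangMills.Cruxes.AtomicCalibrationR.GevreyGridBump (norm_iteratedFDeriv_gridBump_le_gevrey)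
open Summit.QuantumFields.YangMills.Cruxes.AtomicCalibrationR.GevreyPairCutoff (norm_iteratedFDeriv_pairCut_le_gevrey)
open Summit.QuantumFields.YangMills.Cruxes.AtomicCalibrationR.GevreyLeibniz (norm_iteratedFDeriv_mul_le_add_pow_factorial
  norm_iteratedFDeriv_sub_le_pow_factorial)

namespace Summit.QuantumFields.YangMills.Cruxes.AtomicCalibrationR.GevreyBandBump

variable {n : ℕ}

/-- The generic pair cut-off `Π_k(z) = ∏_{l≠l'} ψ(4^k ‖z_l − z_{l'}‖²)` (equals `PairCutoff.pairCut n k` for `ψ = stepψ`). -/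
def cut (ψ : ℝ → ℝ) (n k : ℕ) (z : Fin n → EuclideanSpace ℝ (Fin 4)) : ℝ :=
  ∏ p ∈ pairs n, ψ ((4 : ℝ) ^ k * ‖z p.1 - z p.2‖ ^ 2)

/-- `cut` is `C^∞`. -/
theorem contDiff_cut {ψ : ℝ → ℝ} (hψ : ContDiff ℝ ∞ ψ) (n k : ℕ) : ContDiff ℝ ∞ (cut ψ n k) := by
  unfold cut
  refine contDiff_prod fun p _ => hψ.comp ?_
  have h1 : ContDiff ℝ ∞ (fun z : Fin n → EuclideanSpace ℝ (Fin 4) => z p.1 - z p.2) :=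
    (contDiff_apply ℝ (EuclideanSpace ℝ (Fin 4)) p.1).sub (contDiff_apply ℝ (EuclideanSpace ℝ (Fin 4)) p.2)
  exact contDiff_const.mul (h1.norm_sq ℝ)

/-- `0 ≤ cut ≤ 1` when `0 ≤ ψ ≤ 1`. -/
theorem cut_mem_Icc {ψ : ℝ → ℝ} (hψ0 : ∀ x, 0 ≤ ψ x) (hψ1 : ∀ x, ψ x ≤ 1) (n k : ℕ) (z : Fin n → EuclideanSpace ℝ (Fin 4)) :
    0 ≤ cut ψ n k z ∧ cut ψ n k z ≤ 1 :=
  ⟨Finset.prod_nonneg fun _ _ => hψ0 _, Finset.prod_le_one (fun _ _ => hψ0 _) fun _ _ => hψ1 _⟩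

/-- **Gevrey band bump rate** (all orders, budget-free constants). [folklore] -/
theorem norm_iteratedFDeriv_bandBump_le_gevrey {ρ ψ : ℝ → ℝ} (hρ : ContDiff ℝ ∞ ρ) (hρ1 : ∀ t : ℝ, ‖ρ t‖ ≤ 1)
    (hψ : ContDiff ℝ ∞ ψ) (hψ4 : ∀ x, 4 ≤ x → ψ x = 1) (hψ0 : ∀ x, 0 ≤ ψ x) (hψ1 : ∀ x, ψ x ≤ 1)
    {C₀ C₁ C₀' C₁' : ℝ} (hC₀ : 1 ≤ C₀) (hC₁ : 0 ≤ C₁) (hC₀' : 1 ≤ C₀') (hC₁' : 1 ≤ C₁') {s : ℕ}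
    (hDρ : ∀ (j : ℕ) (t : ℝ), ‖iteratedFDeriv ℝ j ρ t‖ ≤ C₀ * C₁ ^ j * ((Nat.factorial j : ℕ) : ℝ) ^ s)
    (hDψ : ∀ (i : ℕ) (t : ℝ), ‖iteratedFDeriv ℝ i ψ t‖ ≤ C₀' * C₁' ^ i * ((Nat.factorial i : ℕ) : ℝ) ^ s)
    (hn : 1 ≤ n) {h : ℝ} (hh : 0 < h) (k : ℕ) (c : Fin n × Fin 4 → ℤ) (j : ℕ) (z : Fin n → EuclideanSpace ℝ (Fin 4)) :
    ‖iteratedFDeriv ℝ j (fun w => (cut ψ n (k + 1) w - cut ψ n k w) * gridBump ρ n h c w) z‖ ≤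
      ((Nat.factorial j : ℕ) : ℝ) ^ (s + 1) *
        (2 * ((n : ℝ) ^ 2 * (8 * C₀' * C₁' * (2 : ℝ) ^ (k + 1))) + 4 * n * (C₀ * C₁ / h)) ^ j := by
  have hψn : ∀ x : ℝ, ‖ψ x‖ ≤ 1 := fun x => by rw [Real.norm_eq_abs, abs_of_nonneg (hψ0 x)]; exact hψ1 x
  -- the pair cut-off rate `M = n² · 8C₀'C₁' · 2^{k+1}` dominates `1`
  set M : ℝ := (n : ℝ) ^ 2 * (8 * C₀' * C₁' * (2 : ℝ) ^ (k + 1)) with hM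
  have hM1 : 1 ≤ M := by
    have hn' : (1 : ℝ) ≤ (n : ℝ) ^ 2 := one_le_pow₀ (by exact_mod_cast hn)
    have h2 : (1 : ℝ) ≤ (2 : ℝ) ^ (k + 1) := one_le_pow₀ (by norm_num)
    have h8 : (1 : ℝ) ≤ 8 * C₀' * C₁' := by nlinarith
    calc (1 : ℝ) = 1 * (1 * 1) := by ring
      _ ≤ (n : ℝ) ^ 2 * (8 * C₀' * C₁' * (2 : ℝ) ^ (k + 1)) :=
          mul_le_mul hn' (mul_le_mul h8 h2 zero_le_one (by linarith)) (by positivity) (by positivity)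
  have hrate : ∀ (k' i : ℕ), ‖iteratedFDeriv ℝ i (cut ψ n k') z‖ ≤
      ((Nat.factorial i : ℕ) : ℝ) ^ (s + 1) * ((n : ℝ) ^ 2 * (8 * C₀' * C₁' * (2 : ℝ) ^ k')) ^ i :=
    fun k' i => norm_iteratedFDeriv_pairCut_le_gevrey hψ hψ4 hψn hC₀' hC₁' hDψ n k' i z
  -- rates of the difference `(j!)^{s+1} (2M)^j`
  have hsub : ∀ i : ℕ, i ≤ j → ‖iteratedFDeriv ℝ i (fun w => cut ψ n (k + 1) w - cut ψ n k w) z‖ ≤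
      ((Nat.factorial i : ℕ) : ℝ) ^ (s + 1) * (2 * M) ^ i := by
    refine norm_iteratedFDeriv_sub_le_pow_factorial (contDiff_cut hψ n (k + 1)) (contDiff_cut hψ n k) hM1 (s + 1) j z ?_ ?_ ?_
    · rw [Real.norm_eq_abs, abs_le]
      have h1 := cut_mem_Icc hψ0 hψ1 n (k + 1) z
      have h2 := cut_mem_Icc hψ0 hψ1 n k z
      constructor <;> linarith [h1.1, h1.2, h2.1, h2.2]
    · intro i _ _; exact hrate (k + 1) i
    · intro i _ _
      refine (hrate k i).trans (mul_le_mul_of_nonneg_left (pow_le_pow_left₀ (by positivity) ?_ i) (by positivity))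
      rw [hM]
      have h0 : 0 ≤ (n : ℝ) ^ 2 * (8 * C₀' * C₁') := by
        have : (0 : ℝ) ≤ C₀' := by linarith
        have : (0 : ℝ) ≤ C₁' := by linarith
        positivity
      calc (n : ℝ) ^ 2 * (8 * C₀' * C₁' * (2 : ℝ) ^ k) = (n : ℝ) ^ 2 * (8 * C₀' * C₁') * (2 : ℝ) ^ k := by ring
        _ ≤ (n : ℝ) ^ 2 * (8 * C₀' * C₁') * (2 : ℝ) ^ (k + 1) :=
            mul_le_mul_of_nonneg_left (pow_le_pow_right₀ (by norm_num) (Nat.le_succ k)) h0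
        _ = (n : ℝ) ^ 2 * (8 * C₀' * C₁' * (2 : ℝ) ^ (k + 1)) := by ring
  have hg : ∀ i : ℕ, i ≤ j → ‖iteratedFDeriv ℝ i (gridBump ρ n h c) z‖ ≤
      ((Nat.factorial i : ℕ) : ℝ) ^ (s + 1) * (4 * n * (C₀ * C₁ / h)) ^ i := by
    intro i _
    refine (norm_iteratedFDeriv_gridBump_le_gevrey hρ hρ1 hC₀ hC₁ hDρ n hh c i z).trans ?_
    refine mul_le_mul_of_nonneg_right ?_ (by positivity)
    exact pow_le_pow_right₀ (by exact_mod_cast Nat.one_le_iff_ne_zero.2 (Nat.factorial_ne_zero i)) (Nat.le_succ s)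
  have hM0 : 0 ≤ 2 * M := by linarith
  have hG0 : 0 ≤ 4 * n * (C₀ * C₁ / h) :=
    mul_nonneg (mul_nonneg (by norm_num) (Nat.cast_nonneg _)) (div_nonneg (mul_nonneg (by linarith) hC₁) hh.le)
  exact norm_iteratedFDeriv_mul_le_add_pow_factorial ((contDiff_cut hψ n (k + 1)).sub (contDiff_cut hψ n k))
    (contDiff_gridBump hρ n h c) hM0 hG0 (s + 1) j z hsub hg

/-- **Gevrey far bump rate** (all orders). -/
theorem norm_iteratedFDeriv_farBump_le_gevrey {ρ ψ : ℝ → ℝ} (hρ : ContDiff ℝ ∞ ρ) (hρ1 : ∀ t : ℝ, ‖ρ t‖ ≤ 1)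
    (hψ : ContDiff ℝ ∞ ψ) (hψ4 : ∀ x, 4 ≤ x → ψ x = 1) (hψ0 : ∀ x, 0 ≤ ψ x) (hψ1 : ∀ x, ψ x ≤ 1)
    {C₀ C₁ C₀' C₁' : ℝ} (hC₀ : 1 ≤ C₀) (hC₁ : 0 ≤ C₁) (hC₀' : 1 ≤ C₀') (hC₁' : 1 ≤ C₁') {s : ℕ}
    (hDρ : ∀ (j : ℕ) (t : ℝ), ‖iteratedFDeriv ℝ j ρ t‖ ≤ C₀ * C₁ ^ j * ((Nat.factorial j : ℕ) : ℝ) ^ s)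
    (hDψ : ∀ (i : ℕ) (t : ℝ), ‖iteratedFDeriv ℝ i ψ t‖ ≤ C₀' * C₁' ^ i * ((Nat.factorial i : ℕ) : ℝ) ^ s)
    {h : ℝ} (hh : 0 < h) (c : Fin n × Fin 4 → ℤ) (j : ℕ) (z : Fin n → EuclideanSpace ℝ (Fin 4)) :
    ‖iteratedFDeriv ℝ j (fun w => cut ψ n 0 w * gridBump ρ n h c w) z‖ ≤
      ((Nat.factorial j : ℕ) : ℝ) ^ (s + 1) * ((n : ℝ) ^ 2 * (8 * C₀' * C₁') + 4 * n * (C₀ * C₁ / h)) ^ j := by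
  have hψn : ∀ x : ℝ, ‖ψ x‖ ≤ 1 := fun x => by rw [Real.norm_eq_abs, abs_of_nonneg (hψ0 x)]; exact hψ1 x
  have hf : ∀ i : ℕ, i ≤ j → ‖iteratedFDeriv ℝ i (cut ψ n 0) z‖ ≤
      ((Nat.factorial i : ℕ) : ℝ) ^ (s + 1) * ((n : ℝ) ^ 2 * (8 * C₀' * C₁')) ^ i := by
    intro i _
    have h0 : ‖iteratedFDeriv ℝ i (cut ψ n 0) z‖ ≤
        ((Nat.factorial i : ℕ) : ℝ) ^ (s + 1) * ((n : ℝ) ^ 2 * (8 * C₀' * C₁' * (2 : ℝ) ^ 0)) ^ i :=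
      norm_iteratedFDeriv_pairCut_le_gevrey hψ hψ4 hψn hC₀' hC₁' hDψ n 0 i z
    simpa only [pow_zero, mul_one] using h0
  have hg : ∀ i : ℕ, i ≤ j → ‖iteratedFDeriv ℝ i (gridBump ρ n h c) z‖ ≤
      ((Nat.factorial i : ℕ) : ℝ) ^ (s + 1) * (4 * n * (C₀ * C₁ / h)) ^ i := by
    intro i _
    refine (norm_iteratedFDeriv_gridBump_le_gevrey hρ hρ1 hC₀ hC₁ hDρ n hh c i z).trans ?_
    refine mul_le_mul_of_nonneg_right ?_ (by positivity)
    exact pow_le_pow_right₀ (by exact_mod_cast Nat.one_le_iff_ne_zero.2 (Nat.factorial_ne_zero i)) (Nat.le_succ s)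
  have hM0 : 0 ≤ (n : ℝ) ^ 2 * (8 * C₀' * C₁') := by
    have : (0 : ℝ) ≤ C₀' := by linarith
    have : (0 : ℝ) ≤ C₁' := by linarith
    positivity
  have hG0 : 0 ≤ 4 * n * (C₀ * C₁ / h) :=
    mul_nonneg (mul_nonneg (by norm_num) (Nat.cast_nonneg _)) (div_nonneg (mul_nonneg (by linarith) hC₁) hh.le)
  exact norm_iteratedFDeriv_mul_le_add_pow_factorial (contDiff_cut hψ n 0) (contDiff_gridBump hρ n h c) hM0 hG0 (s + 1) j z
    hf hg

end Summit.QuantumFields.YangMills.Cruxes.AtomicCalibrationR.GevreyBandBump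

end
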